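import Summits.ResolutionOfSingularities.ResolutionOfSingularities.Theorems.FrobeniusClosingPatchingRelPerfectConeDepthLineClimb
import Summits.ResolutionOfSingularities.ResolutionOfSingularities.Theorems.FrobeniusClosingPatchingRelPerfectConeDepthSmoothConeRung
import HarnessLib

/-!
# Crux `PatchingRelPerfect` (stmt-ResolutionOfSingularities-16161), chain W5.2 — RUNG «r-binary-disc-ℓ» BY NAME: the BINARY FORM
# WITH UNIT DISCRIMINANT at EVERY exceptional depth, `(x₀² + b x₀x₁ + a x₁²) + 𝔪^{ℓ+2} ∈ 𝒞`

[OURS · L1 W5.2 · rung tool] Replaces the role of NO printed item; NOT a statement of the manuscript under review; fact-free,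
any characteristic, any residue field.  AI-written (AI review is weaker than expert review).

For `S` regular local of dimension four with regular system of parameters `x`, `a, b ∈ S` with `b² − 4a ∈ S×` (the reduced form
`T₀² + b̄T₀T₁ + āT₁²` is a non-degenerate binary form over the residue field — split, or irreducible, i.e. a "norm form"; its
zero set in `Spec S` is singular along the PLANE `V(x₀, x₁)`), and every `ℓ`: `(x₀x₀ + b x₀x₁ + a x₁x₁) + 𝔪^{ℓ+2}` has an
`𝔪`-primary companion with a regular blowing up, and the blow-up-form core conclusion holds for every `Bl_I Spec S`.  The proof is
the LINE LADDER: blow up the closed point (`LineState.initial`, THE POINT FIBRE THEOREM), then repeatedly the bad line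
(`LineState.step`, THE LINE FIBRE THEOREM) until the exponent is exhausted (`LineState.companion`), then the END.  This completes
the rank-`2` non-split type of the `d = 2` one-form graded members (rank `≤ 2` split types are monomial; ranks `3, 4`:
`…SmoothConeRung`, `…SmoothQuadricRung`).

## References
* J. Kollár, *Lectures on Resolution of Singularities* (2007), 3.61, (3.111) Step 3. [Kollar2007]
* The Stacks Project, Tag 080A. [StacksProject]
-/

set_option linter.dupNamespace false

noncomputable section

open CategoryTheory CategoryTheory.Limits AlgebraicGeometry TopologicalSpace IsLocalRing
open Literature.AlgebraicGeometry.Resolution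
open Scheme.IdealSheafData
open scoped Pointwise

namespace Summit.ResolutionOfSingularities.ResolutionOfSingularities.Theorems

universe u

namespace ConeDepth

section Rung

variable {S : Type u} [CommRing S] [IsRegularLocalRing S]
  (x : Fin 4 → S) (hx : Ideal.span (Set.range x) = maximalIdeal S) (hdim : ringKrullDim S = (4 : ℕ))
  (a b : S) (hD : IsUnit (b ^ 2 - 4 * a)) (ℓ : ℕ)

include hx hdim hD in
/-- **RUNG «r-binary-disc-ℓ», UNCONDITIONAL PACKAGE**: for `S` regular local of dimension `4`, `x` spanning `𝔪`, `b² − 4a` a unit,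
`q = x₀x₀ + b x₀x₁ + a x₁x₁` and EVERY `ℓ`: (1) `(q) + 𝔪^{ℓ+2} ∈ 𝒞` — an `𝔪`-primary companion `Q ⊇ 𝔪^m` with a REGULAR blowing
up of `Spec S` along `I · Q`; (2) the blow-up-form core conclusion for every `T = Bl_I Spec S`, `I = (q) + 𝔪^{ℓ+2}`.  Every
characteristic, every residue field, no completeness, fact-free. [cite: Kollar2007, 3.61 and (3.111) Step 3]
[cite: StacksProject, Tag 080A] -/
theorem binaryDiscRung_of_ringKrullDim :
    (∃ (Q : Ideal S) (m : ℕ), IsLocalRing.maximalIdeal S ^ m ≤ Q ∧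
      ∃ (B' : Scheme.{u}) (β : B' ⟶ Spec (.of S)),
        IsBlowup β (affineBlowup.idealSheaf
          ((Ideal.span {x 0 * x 0 + b * (x 0 * x 1) + a * (x 1 * x 1)} ⊔ maximalIdeal S ^ (ℓ + 2)) * Q)) ∧
        Scheme.IsRegular B') ∧
    (∀ (T : Scheme.{u}) (f : T ⟶ Spec (.of S)),
      IsBlowup f (affineBlowup.idealSheaf
        (Ideal.span {x 0 * x 0 + b * (x 0 * x 1) + a * (x 1 * x 1)} ⊔ maximalIdeal S ^ (ℓ + 2))) →
      ∃ (J : T.IdealSheafData) (T' : Scheme.{u}) (π : T' ⟶ T), J ≠ ⊥ ∧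
        (∀ t : T, t ∈ J.support → f.base t = IsLocalRing.closedPoint S) ∧
        IsBlowup π J ∧ Scheme.IsRegular T') := by
  have hd : (maximalIdeal S).spanFinrank = 4 := spanFinrank_maximalIdeal_eq_four hdim
  haveI : IsDomain S := isDomain_of_isRegularLocalRing S
  have h𝔪 : maximalIdeal S ≠ ⊥ := maximalIdeal_ne_bot_of_spanFinrank hd
  have hI : Ideal.span {x 0 * x 0 + b * (x 0 * x 1) + a * (x 1 * x 1)} ⊔ maximalIdeal S ^ (ℓ + 2) ≠ ⊥ := fun h =>
    pow_ne_zero (ℓ + 2) h𝔪 (eq_bot_iff.mpr (le_sup_right.trans h.le))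
  have hIm : ((affineBlowup.idealSheaf
      (Ideal.span {x 0 * x 0 + b * (x 0 * x 1) + a * (x 1 * x 1)} ⊔ maximalIdeal S ^ (ℓ + 2))).support :
      Set (Spec (.of S))) ⊆ {IsLocalRing.closedPoint S} := fun s hs =>
    Set.mem_singleton_iff.mpr (support_idealSheaf_subset_closedPoint (n := ℓ + 2) le_sup_right s hs)
  have h₁ := LineState.initial x hx hd a b hD ℓ
  have hcomp := LineState.companion hI hIm ℓ h₁
  exact ⟨hcomp, fun T f hf => atomConclusion_of_companion' hI hcomp T f hf⟩

include hx hdim hD in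
/-- **The same rung for `q` written with powers**, `q = x₀² + b x₀x₁ + a x₁²`. [cite: Kollar2007, 3.61] -/
theorem binaryDiscRung_of_ringKrullDim' :
    (∃ (Q : Ideal S) (m : ℕ), IsLocalRing.maximalIdeal S ^ m ≤ Q ∧
      ∃ (B' : Scheme.{u}) (β : B' ⟶ Spec (.of S)),
        IsBlowup β (affineBlowup.idealSheaf
          ((Ideal.span {x 0 ^ 2 + b * x 0 * x 1 + a * x 1 ^ 2} ⊔ maximalIdeal S ^ (ℓ + 2)) * Q)) ∧
        Scheme.IsRegular B') ∧
    (∀ (T : Scheme.{u}) (f : T ⟶ Spec (.of S)),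
      IsBlowup f (affineBlowup.idealSheaf
        (Ideal.span {x 0 ^ 2 + b * x 0 * x 1 + a * x 1 ^ 2} ⊔ maximalIdeal S ^ (ℓ + 2))) →
      ∃ (J : T.IdealSheafData) (T' : Scheme.{u}) (π : T' ⟶ T), J ≠ ⊥ ∧
        (∀ t : T, t ∈ J.support → f.base t = IsLocalRing.closedPoint S) ∧
        IsBlowup π J ∧ Scheme.IsRegular T') := by
  have hq : x 0 ^ 2 + b * x 0 * x 1 + a * x 1 ^ 2 = x 0 * x 0 + b * (x 0 * x 1) + a * (x 1 * x 1) := by ring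
  rw [hq]
  exact binaryDiscRung_of_ringKrullDim x hx hdim a b hD ℓ

end Rung

/-- **The registered core's binder shape on the member `(x₀² + b x₀x₁ + a x₁²) + 𝔪^{ℓ+2}`**, `b² − 4a` a unit (hypotheses of
`stub_atomDimFourBlowup`; characteristic, completeness, perfectness of the residue field and the off-fibre hypothesis unused).
[cite: Kollar2007, 3.61] -/
theorem atomDimFourBlowupAt_binaryDisc (p : ℕ) (_hp : p.Prime) (S : Type) [CommRing S]
    [IsRegularLocalRing S] [CharP S p] [IsAdicComplete (IsLocalRing.maximalIdeal S) S]
    [PerfectField (IsLocalRing.ResidueField S)] (hS : ringKrullDim S = (4 : ℕ))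
    (x : Fin 4 → S) (hx : Ideal.span (Set.range x) = IsLocalRing.maximalIdeal S)
    (a b : S) (hD : IsUnit (b ^ 2 - 4 * a)) (ℓ : ℕ)
    (T : Scheme.{0}) (f : T ⟶ Spec (.of S))
    (hf : IsBlowup f (affineBlowup.idealSheaf
      (Ideal.span {x 0 ^ 2 + b * x 0 * x 1 + a * x 1 ^ 2} ⊔ IsLocalRing.maximalIdeal S ^ (ℓ + 2))))
    (_hoff : ∀ t : T, f.base t ≠ IsLocalRing.closedPoint S → IsRegularLocalRing (T.presheaf.stalk t)) :
    ∃ (J : T.IdealSheafData) (T' : Scheme.{0}) (π : T' ⟶ T), J ≠ ⊥ ∧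
      (∀ t : T, t ∈ J.support → f.base t = IsLocalRing.closedPoint S) ∧
      IsBlowup π J ∧ Scheme.IsRegular T' :=
  (binaryDiscRung_of_ringKrullDim' x hx hS a b hD ℓ).2 T f hf

end ConeDepth

end Summit.ResolutionOfSingularities.ResolutionOfSingularities.Theorems

end
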